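import Literature.RepresentationTheory.Virasoro.VermaModulePBW

/-!
# Generic injectivity of the Verma-to-Fock map along the Feigin–Fuchs curve

The universal map `Γ_{λ,η} : V(c_λ, h_λ^η) → F_λ^η`, `v ↦ |η⟩` (Iohara–Koga §4.5.1) is injective on
level `n` exactly when the PBW words `e_𝕀 |η⟩`, `𝕀 ⊢ n`, are linearly independent in the Fock module
(`dim V_{h+n} = p(n)`, `Literature.RepresentationTheory.Virasoro.VermaModulePBW`); by Iohara–Koga
Theorem 4.3 (1) this fails only on the curves `Ψ⁺_{r,s}(λ,η) = 0`. Here we prove the generic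
statement we need along the ONE-parameter family through the Kac table used in Lemma 4.11:
`λ(β) = β/2 - 1/β`, `μ_{r,s}(β) = (r+1)β/2 - (s+1)/β` (so that for `β² = 2t`: `c_λ = c(t)`,
`h_λ^μ = h_{r,s}(t)`):

* **`exists_finset_linearIndependent_partitionVector r s N`**: for all but finitely many `β ∈ ℂ` the
  words `e_𝕀 |μ_{r,s}(β)⟩`, `𝕀 ⊢ N`, of `F_{λ(β)}^{μ_{r,s}(β)}` are linearly independent.

The proof is the one of `Fock.exists_linearIndependent_partitionVector` (generic `μ` at `λ = 0`)
transported to this family: the coefficient of `x_k` in `β L_{-k}` is `β(μ + (k-1)λ) = (r+k)β²/2 - (s+k)`,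
a POLYNOMIAL in `β` of degree `2` with leading coefficient `(r+k)/2 ≠ 0`, while the other terms of
`β L_{-k}` have degree `1`; so after the normalisation `𝓛_k = (2/(r+k)) β L_{-k}` (`crea`, over `ℂ[β]`)
the coefficient of `x_𝕀` in `𝓛_𝕀 1` is MONIC of degree `2ℓ(𝕀)` and all other coefficients have smaller
degree (`coeff_gvec`), the determinant of the coefficient matrix is a monic polynomial in `β`
(Iohara–Koga Lemma 4.9's degree count), and away from its roots (and `β = 0`) the specialised words —
non-zero multiples of the `e_𝕀 |μ(β)⟩` (`map_gvec`) — are independent.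

## References

* [IoharaKoga2011] K. Iohara, Y. Koga, *Representation theory of the Virasoro algebra*, Springer 2011,
  §4.5.1, Theorem 4.3 (1), Lemma 4.9, Lemma 4.11.
-/

noncomputable section

namespace Literature.RepresentationTheory.Virasoro

namespace Fock

open Polynomial

/-! ### The creation operators with arbitrary parameters -/

/-- **The creation operators of `F_λ^μ`**: `L_{-k} q = (μ + (k-1)λ) x_k q + (½ Σ x_i x_{k-i}) q + D_{-k} q`
(`k ≥ 1`, any `λ, μ`). [cite: IoharaKoga2011, eqs. (4.1)–(4.3)] -/
theorem rep_L_neg_apply (lam mu : ℂ) (k : ℕ) (hk : 0 < k) (q : Space ℂ) :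
    (rep (R := ℂ) lam mu).L (-(k : ℤ)) q =
      (mu + (k - 1) * lam) • (x ℂ k * q) + (quad ℂ k * q + Fock.D ℂ 0 0 (-(k : ℤ)) q) := by
  have h0 : (-(k : ℤ)).toNat = 0 := by simp
  have h1 : (-(-(k : ℤ))).toNat = k := by simp
  rw [rep_L_apply, Algebra.algebraMap_self_apply]
  simp only [L, LinearMap.add_apply, LinearMap.mulLeft_apply, Derivation.coeFn_coe, h0, aa_zero,
    add_zero, if_neg (show (-(k : ℤ)) ≠ 0 by omega), zero_smul, P, h1, add_mul, smul_mul_assoc]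
  rw [D_eq_of_neg lam mu 0 0 (by omega : (-(k : ℤ)) < 0)]
  have e : (mu - lam * (1 + ((-(k : ℤ) : ℤ) : ℂ))) = mu + (k - 1) * lam := by push_cast; ring
  rw [e]
  abel

/-! ### The Feigin–Fuchs curve through the Kac table, parametrised by `β` (`β² = 2t`) -/

/-- `λ(β) = β/2 - 1/β` (so that `c_λ = 13 - 3β² - 12/β² = 13 - 6(t + t⁻¹)` for `β² = 2t`).
[cite: IoharaKoga2011, Lemma 4.5 and Lemma 4.11] -/
def lamOf (β : ℂ) : ℂ := β / 2 - β⁻¹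

/-- `μ_{r,s}(β) = (r+1)β/2 - (s+1)/β` (so that `h_λ^μ = h_{r,s}(t)` for `β² = 2t`).
[cite: IoharaKoga2011, Lemma 4.11 (η = ((r+1)t - (s+1))/√(2t))] -/
def muOf (r s : ℕ) (β : ℂ) : ℂ := (r + 1) * β / 2 - (s + 1) * β⁻¹

/-- `β (μ + (k-1)λ) = (r+k)β²/2 - (s+k)`: the rescaled coefficient of `x_k` in `L_{-k}` is a
POLYNOMIAL in `β`. [folklore] -/
theorem beta_mul_coeff (r s : ℕ) {β : ℂ} (hβ : β ≠ 0) (k : ℕ) :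
    β * (muOf r s β + (k - 1) * lamOf β) = (r + k) * β ^ 2 / 2 - (s + k) := by
  rw [muOf, lamOf]
  field_simp
  ring

/-! ### The rescaled creation operators over `ℂ[β]` -/

section Family

/-- The normalising constant `2/(r+k)` (non-zero for `k ≥ 1`). [folklore] -/
def cst (r k : ℕ) : ℂ := 2 / ((r : ℂ) + k)

/-- The monic quadratic `q_k(β) = β² - 2(s+k)/(r+k) = (2/(r+k)) · β(μ + (k-1)λ)`. [folklore] -/
def qm (r s k : ℕ) : Polynomial ℂ := Polynomial.X ^ 2 - Polynomial.C (2 * ((s : ℂ) + k) / ((r : ℂ) + k))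

/-- `q_k` is monic of degree `2`. [folklore] -/
theorem qm_monic (r s k : ℕ) : (qm r s k).Monic := by
  rw [qm]; exact monic_X_pow_sub_C _ two_ne_zero

/-- `deg q_k = 2`. [folklore] -/
theorem qm_natDegree (r s k : ℕ) : (qm r s k).natDegree = 2 := by
  rw [qm, natDegree_X_pow_sub_C]

/-- **The rescaled creation operator** `𝓛_k = (2/(r+k)) β L_{-k}` over `ℂ[β]`:
`𝓛_k v = q_k(β) x_k v + β (2/(r+k)) (½ Σ x_i x_{k-i} + D_{-k}) v` — POLYNOMIAL in `β`.
[cite: IoharaKoga2011, eqs. (4.1)–(4.3)] -/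
def crea (r s k : ℕ) (v : Space ℂ[X]) : Space ℂ[X] :=
  qm r s k • (x ℂ[X] k * v) +
    (Polynomial.X * Polynomial.C (cst r k)) • (quad ℂ[X] k * v + Fock.D ℂ[X] 0 0 (-(k : ℤ)) v)

/-- The rescaled words `𝓛_{k₁} ⋯ 𝓛_{k_j} 1`. [folklore] -/
def gvec (r s : ℕ) : List ℕ → Space ℂ[X]
  | [] => 1
  | k :: l => crea r s k (gvec r s l)

/-- Unfolding on the empty word. [folklore] -/
@[simp] theorem gvec_nil (r s : ℕ) : gvec r s [] = 1 := rfl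

/-- Unfolding on a non-empty word. [folklore] -/
theorem gvec_cons (r s k : ℕ) (l : List ℕ) : gvec r s (k :: l) = crea r s k (gvec r s l) := rfl

/-- The scalar by which the rescaled word specialises: `∏_k 2β/(r+k)`. [folklore] -/
def scal (r : ℕ) (β : ℂ) (l : List ℕ) : ℂ := (l.map fun k => β * cst r k).prod

/-- The normalising constants are non-zero on positive letters. [folklore] -/
theorem cst_ne_zero (r : ℕ) {k : ℕ} (hk : 0 < k) : cst r k ≠ 0 := by
  rw [cst]
  refine div_ne_zero two_ne_zero ?_
  exact_mod_cast (show (r + k : ℕ) ≠ 0 by omega)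

/-- The specialisation scalar is non-zero for `β ≠ 0`. [folklore] -/
theorem scal_ne_zero (r : ℕ) {β : ℂ} (hβ : β ≠ 0) {l : List ℕ} (hl : ∀ k ∈ l, 0 < k) : scal r β l ≠ 0 := by
  rw [scal]
  refine List.prod_ne_zero fun h => ?_
  obtain ⟨k, hk, hk0⟩ := List.mem_map.mp h
  exact mul_ne_zero hβ (cst_ne_zero r (hl k hk)) hk0

end Family

/-! ### Specialisation `β ↦ β₀` -/

section Specialise

/-- `q_k(β₀) = (2β₀/(r+k)) (μ(β₀) + (k-1)λ(β₀))`. [folklore] -/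
theorem aeval_qm (r s : ℕ) {β₀ : ℂ} (hβ : β₀ ≠ 0) (k : ℕ) (hk : 0 < k) :
    Polynomial.aeval β₀ (qm r s k) = β₀ * cst r k * (muOf r s β₀ + (k - 1) * lamOf β₀) := by
  rw [mul_right_comm, beta_mul_coeff r s hβ k, qm, cst, map_sub, map_pow, Polynomial.aeval_X, Polynomial.aeval_C,
    Algebra.algebraMap_self_apply]
  have h : ((r : ℂ) + k) ≠ 0 := by exact_mod_cast (show (r + k : ℕ) ≠ 0 by omega)
  field_simp

/-- **Specialisation of the rescaled words**: at `β = β₀ ≠ 0` the rescaled word `𝓛_{k₁}⋯𝓛_{k_j} 1`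
becomes `(∏ 2β₀/(r+kᵢ)) · L_{-k₁} ⋯ L_{-k_j} |μ(β₀)⟩` in the Fock module `F_{λ(β₀)}^{μ(β₀)}`. [folklore] -/
theorem map_gvec (r s : ℕ) {β₀ : ℂ} (hβ : β₀ ≠ 0) {l : List ℕ} (hl : ∀ k ∈ l, 0 < k) :
    MvPolynomial.map (Polynomial.aeval β₀ : ℂ[X] →ₐ[ℂ] ℂ) (gvec r s l) =
      scal r β₀ l • (rep (R := ℂ) (lamOf β₀) (muOf r s β₀)).pbwVector l 1 := by
  induction l with
  | nil => simp [scal]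
  | cons k l ih =>
    have hk : 0 < k := hl k List.mem_cons_self
    have ih' := ih fun j hj => hl j (List.mem_cons_of_mem k hj)
    set φ : ℂ[X] →ₐ[ℂ] ℂ := Polynomial.aeval β₀ with hφ
    set e := (rep (R := ℂ) (lamOf β₀) (muOf r s β₀)).pbwVector l 1 with he
    set y : ℂ := muOf r s β₀ + (k - 1) * lamOf β₀ with hy
    have hD : MvPolynomial.map (φ : ℂ[X] →+* ℂ) (Fock.D ℂ[X] 0 0 (-(k : ℤ)) (gvec r s l)) =
        scal r β₀ l • Fock.D ℂ 0 0 (-(k : ℤ)) e := by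
      rw [map_D, map_zero, ih', Derivation.map_smul]
    have hq : φ (qm r s k) = β₀ * cst r k * y := aeval_qm r s hβ k hk
    have hφX : φ Polynomial.X = β₀ := by rw [hφ, Polynomial.aeval_X]
    have hφC : ∀ c : ℂ, φ (Polynomial.C c) = c := fun c => by
      rw [hφ, Polynomial.aeval_C, Algebra.algebraMap_self_apply]
    rw [gvec_cons, crea, scal, List.map_cons, List.prod_cons, ← scal, VirasoroRep.pbwVector_cons, ← he,
      rep_L_neg_apply _ _ k hk, ← hy]
    simp only [map_add, map_mul, MvPolynomial.smul_eq_C_mul, MvPolynomial.map_C, map_x, map_quad, hD, ih',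
      AlgHom.coe_toRingHom, hq, hφX, hφC]
    ring

end Specialise

/-! ### The leading terms in `β` -/

section Degree

/-- Scalar multiplication by a polynomial of degree `≤ d` raises the coefficient bound by `d`. [folklore] -/
theorem DegLE.smul_of_degree_le {D d : ℕ} {q : Space ℂ[X]} (hq : DegLE D q) {f : ℂ[X]} (hf : f.degree ≤ d) :
    DegLE (D + d) (f • q) := by
  intro t
  rw [MvPolynomial.coeff_smul, smul_eq_mul]
  refine (degree_mul_le _ _).trans ?_
  calc f.degree + (MvPolynomial.coeff t q).degree ≤ (d : WithBot ℕ) + (D : WithBot ℕ) := add_le_add hf (hq t)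
    _ = ((D + d : ℕ) : WithBot ℕ) := by push_cast; ring

/-- The product `Q_l = ∏_{k ∈ l} q_k` of the monic quadratics. [folklore] -/
def qprod (r s : ℕ) (l : List ℕ) : ℂ[X] := (l.map (qm r s)).prod

/-- Unfolding `Q` on a non-empty word. [folklore] -/
theorem qprod_cons (r s k : ℕ) (l : List ℕ) : qprod r s (k :: l) = qm r s k * qprod r s l := by
  rw [qprod, qprod, List.map_cons, List.prod_cons]

/-- `Q_l` is monic of degree `2|l|`. [folklore] -/
theorem qprod_monic_natDegree (r s : ℕ) (l : List ℕ) :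
    (qprod r s l).Monic ∧ (qprod r s l).natDegree = 2 * l.length := by
  induction l with
  | nil => simp [qprod]
  | cons k l ih =>
    rw [qprod_cons]
    refine ⟨(qm_monic r s k).mul ih.1, ?_⟩
    rw [(qm_monic r s k).natDegree_mul ih.1, qm_natDegree, ih.2, List.length_cons]
    ring

/-- **Leading terms of the rescaled words**: for a word `l` in positive letters the coefficient of
`x_l` in `𝓛_l 1` is `Q_l(β) +` (degree `< 2|l|`), and every other coefficient has degree `< 2|l|`
(each `𝓛_k` contributes its top term `q_k(β) x_k`, the rest having degree `≤ 1` in `β`).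
[cite: IoharaKoga2011, Lemma 4.9 (degree count of the leading term)] -/
theorem coeff_gvec (r s : ℕ) {l : List ℕ} (hl : ∀ k ∈ l, 0 < k) :
    (∃ rem : ℂ[X], MvPolynomial.coeff (monoOf l) (gvec r s l) = qprod r s l + rem ∧
        rem.degree < ((2 * l.length : ℕ) : WithBot ℕ)) ∧
      (∀ t, t ≠ monoOf l → (MvPolynomial.coeff t (gvec r s l)).degree < ((2 * l.length : ℕ) : WithBot ℕ)) := by
  induction l with
  | nil =>
    refine ⟨⟨0, by simp [qprod], by simp⟩, fun t ht => ?_⟩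
    rw [gvec_nil, monoOf_nil] at *
    rw [MvPolynomial.coeff_one, if_neg (Ne.symm ht), degree_zero, List.length_nil]
    exact WithBot.bot_lt_coe _
  | cons k l ih =>
    have hk : 0 < k := hl k List.mem_cons_self
    obtain ⟨⟨rem, hrem, hremdeg⟩, hoff⟩ := ih fun j hj => hl j (List.mem_cons_of_mem k hj)
    obtain ⟨hQmon, hQdeg⟩ := qprod_monic_natDegree r s l
    set W := gvec r s l with hW
    -- all coefficients of `W` have degree `≤ 2ℓ`
    have hWdeg : DegLE (2 * l.length) W := by
      intro t
      by_cases ht : t = monoOf l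
      · rw [ht, hrem]
        refine (degree_add_le _ _).trans (max_le ?_ hremdeg.le)
        rw [degree_eq_natDegree hQmon.ne_zero, hQdeg]
      · exact (hoff t ht).le
    -- the part of degree `≤ 2ℓ + 1`
    set T := (Polynomial.X * Polynomial.C (cst r k)) • (quad ℂ[X] k * W + Fock.D ℂ[X] 0 0 (-(k : ℤ)) W) with hT
    have hTdeg : DegLE (2 * l.length + 1) T := by
      refine DegLE.smul_of_degree_le (DegLE.add ?_ (hWdeg.D_apply _ _ (by omega))) ?_
      · refine DegLE.mul_left ?_ hWdeg
        rw [← map_quad (Algebra.ofId ℂ ℂ[X]) k]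
        exact degLE_zero_map _
      · refine (degree_mul_le _ _).trans ?_
        calc (Polynomial.X : ℂ[X]).degree + (Polynomial.C (cst r k)).degree ≤ 1 + 0 :=
              add_le_add degree_X_le degree_C_le
          _ = (1 : ℕ) := by norm_num
    have hstep : gvec r s (k :: l) = qm r s k • (x ℂ[X] k * W) + T := rfl
    -- coefficients of `x_k * W`
    have hxW : ∀ t, MvPolynomial.coeff t (x ℂ[X] k * W) =
        if Nat.toPNat' k ∈ t.support then MvPolynomial.coeff (t - Finsupp.single (Nat.toPNat' k) 1) W else 0 := by
      intro t
      rw [x_of_pos hk, show (⟨k, hk⟩ : ℕ+) = Nat.toPNat' k from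
          PNat.eq (by simp [Nat.toPNat'_coe, hk]), MvPolynomial.coeff_X_mul']
    have hqmdeg : (qm r s k).degree = 2 := by
      rw [degree_eq_natDegree (qm_monic r s k).ne_zero, qm_natDegree]; rfl
    have hlen : ((2 * (k :: l).length : ℕ) : WithBot ℕ) = 2 + ((2 * l.length : ℕ) : WithBot ℕ) := by
      rw [List.length_cons]; push_cast; ring
    refine ⟨⟨qm r s k * rem + MvPolynomial.coeff (monoOf (k :: l)) T, ?_, ?_⟩, fun t ht => ?_⟩
    · rw [hstep, MvPolynomial.coeff_add, MvPolynomial.coeff_smul, smul_eq_mul, hxW, monoOf_cons, if_pos (by simp),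
        add_tsub_cancel_left, hrem, qprod_cons]
      ring
    · rw [hlen]
      refine (degree_add_le _ _).trans_lt (max_lt ?_ ?_)
      · rw [degree_mul, hqmdeg]
        exact WithBot.add_lt_add_left (by decide) hremdeg
      · refine (hTdeg _).trans_lt ?_
        exact_mod_cast (show 2 * l.length + 1 < 2 + 2 * l.length by omega)
    · rw [hstep, MvPolynomial.coeff_add, MvPolynomial.coeff_smul, smul_eq_mul, hxW, hlen]
      refine (degree_add_le _ _).trans_lt (max_lt ?_ ?_)
      · split_ifs with hmem
        · have hne : t - Finsupp.single (Nat.toPNat' k) 1 ≠ monoOf l := by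
            intro h
            apply ht
            rw [monoOf_cons, ← h, add_comm, Finsupp.sub_add_single_one_cancel]
            exact Finsupp.mem_support_iff.mp hmem
          rw [degree_mul, hqmdeg]
          exact WithBot.add_lt_add_left (by decide) (hoff _ hne)
        · rw [mul_zero, degree_zero]
          exact WithBot.bot_lt_coe _
      · refine (hTdeg _).trans_lt ?_
        exact_mod_cast (show 2 * l.length + 1 < 2 + 2 * l.length by omega)

end Degree

/-! ### Generic injectivity -/

section Generic

/-- **Generic injectivity of the Verma-to-Fock map along the Feigin–Fuchs curve.** For all but
finitely many `β₀ ∈ ℂ` the PBW words `e_𝕀 |μ(β₀)⟩`, `𝕀 ⊢ N`, of the Fock module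
`F_{λ(β₀)}^{μ_{r,s}(β₀)}` are linearly independent, i.e. the universal map
`V(c_{λ(β₀)}, h_{r,s}) → F_{λ(β₀)}^{μ_{r,s}(β₀)}` is injective on level `N`: the determinant of the
coefficients of the rescaled words on the monomials `x_𝕁` is a polynomial in `β` of degree exactly
`2 Σ_𝕀 ℓ(𝕀)` with leading coefficient `1` (after the normalisation by `∏ 2/(r+k)`).
[cite: IoharaKoga2011, Theorem 4.3 (1) (det(Γ_{λ,η})_n ≠ 0 off the curves Ψ⁺_{r,s} = 0) and Lemma 4.9] -/
theorem exists_finset_linearIndependent_partitionVector (r s N : ℕ) :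
    ∃ bad : Finset ℂ, ∀ β₀ : ℂ, β₀ ∉ bad →
      LinearIndependent ℂ fun p : Nat.Partition N => (rep (R := ℂ) (lamOf β₀) (muOf r s β₀)).partitionVector p 1 := by
  classical
  -- data attached to a partition
  let lst : Nat.Partition N → List ℕ := fun p => (p.parts.sort (· ≤ ·)).reverse
  have hlst : ∀ p, ∀ k ∈ lst p, 0 < k := fun p k hk => by
    rw [List.mem_reverse, Multiset.mem_sort] at hk
    exact p.parts_pos hk
  have hlst_coe : ∀ p, (lst p : Multiset ℕ) = p.parts := fun p => by
    rw [Multiset.coe_reverse, Multiset.sort_eq]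
  let mo : Nat.Partition N → (ℕ+ →₀ ℕ) := fun p => monoOf (lst p)
  have hmo : Function.Injective mo := by
    intro p q h
    have h1 := coe_eq_of_monoOf_eq (hlst p) (hlst q) h
    rw [hlst_coe, hlst_coe] at h1
    exact Nat.Partition.ext h1
  let ℓ : Nat.Partition N → ℕ := fun p => 2 * (lst p).length
  -- the matrix of coefficients
  let A : Matrix (Nat.Partition N) (Nat.Partition N) ℂ[X] :=
    fun p q => MvPolynomial.coeff (mo q) (gvec r s (lst p))
  have hA : ∀ p q, (p = q → ∃ rem : ℂ[X], A p q = qprod r s (lst p) + rem ∧ rem.degree < ℓ p) ∧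
      (p ≠ q → (A p q).degree < ℓ p) := by
    intro p q
    have h := coeff_gvec r s (hlst p)
    refine ⟨fun hpq => ?_, fun hpq => ?_⟩
    · subst hpq; exact h.1
    · exact h.2 _ fun hh => hpq (hmo hh.symm)
  -- the diagonal entries are monic of degree `ℓ p`
  have hmon : ∀ p, (A p p).Monic ∧ (A p p).natDegree = ℓ p := by
    intro p
    obtain ⟨rem, hr, hrdeg⟩ := (hA p p).1 rfl
    obtain ⟨hQmon, hQdeg⟩ := qprod_monic_natDegree r s (lst p)
    have hlt : rem.degree < (qprod r s (lst p)).degree := by rwa [degree_eq_natDegree hQmon.ne_zero, hQdeg]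
    rw [hr]
    exact ⟨hQmon.add_of_left hlt, by rw [natDegree_add_eq_left_of_degree_lt hlt, hQdeg]⟩
  have hdiag_monic : (∏ p, A p p).Monic := monic_prod_of_monic _ _ fun p _ => (hmon p).1
  have hdiag_deg : (∏ p, A p p).natDegree = ∑ p, ℓ p := by
    rw [natDegree_prod_of_monic _ _ fun p _ => (hmon p).1]
    exact Finset.sum_congr rfl fun p _ => (hmon p).2
  -- the other terms of the determinant have smaller degree
  have hoff : ∀ σ : Equiv.Perm (Nat.Partition N), σ ≠ 1 →
      (Equiv.Perm.sign σ • ∏ p, A (σ p) p).degree < ((∑ p, ℓ p : ℕ) : WithBot ℕ) := by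
    intro σ hσ
    have hsign : (Equiv.Perm.sign σ • ∏ p, A (σ p) p).degree ≤ (∏ p, A (σ p) p).degree := by
      rcases Int.units_eq_one_or (Equiv.Perm.sign σ) with h | h
      · rw [h, one_smul]
      · rw [h, Units.neg_smul, one_smul, degree_neg]
    refine hsign.trans_lt ?_
    by_cases hzero : ∃ p, A (σ p) p = 0
    · obtain ⟨p, hp⟩ := hzero
      rw [Finset.prod_eq_zero (f := fun q => A (σ q) q) (Finset.mem_univ p) hp, degree_zero]
      exact WithBot.bot_lt_coe _
    · have hz : ∀ p, A (σ p) p ≠ 0 := fun p hp => hzero ⟨p, hp⟩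
      rw [degree_eq_natDegree (Finset.prod_ne_zero_iff.mpr fun p _ => hz p)]
      have hle : ∀ p, (A (σ p) p).natDegree ≤ ℓ (σ p) := by
        intro p
        by_cases hp : σ p = p
        · rw [hp]; exact (hmon p).2.le
        · exact Nat.le_of_lt ((natDegree_lt_iff_degree_lt (hz p)).mpr ((hA _ _).2 hp))
      obtain ⟨p₀, hp₀⟩ : ∃ p₀, σ p₀ ≠ p₀ := by
        by_contra hcon
        apply hσ
        refine Equiv.ext fun p => ?_
        by_contra hp
        exact hcon ⟨p, hp⟩
      have hlt : (A (σ p₀) p₀).natDegree < ℓ (σ p₀) :=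
        (natDegree_lt_iff_degree_lt (hz p₀)).mpr ((hA _ _).2 hp₀)
      have hnat : (∏ p, A (σ p) p).natDegree < ∑ p, ℓ p := by
        rw [natDegree_prod _ _ fun p _ => hz p]
        calc ∑ p, (A (σ p) p).natDegree < ∑ p, ℓ (σ p) :=
              Finset.sum_lt_sum (fun p _ => hle p) ⟨p₀, Finset.mem_univ _, hlt⟩
          _ = ∑ p, ℓ p := Equiv.sum_comp σ ℓ
      exact_mod_cast hnat
  -- hence the determinant is monic, in particular non-zero
  have hdet : A.det ≠ 0 := by
    rw [Matrix.det_apply, ← Finset.add_sum_erase _ _ (Finset.mem_univ (1 : Equiv.Perm (Nat.Partition N)))]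
    simp only [Equiv.Perm.sign_one, one_smul, Equiv.Perm.coe_one, id_eq]
    refine (hdiag_monic.add_of_left ?_).ne_zero
    rw [degree_eq_natDegree hdiag_monic.ne_zero, hdiag_deg]
    refine (degree_sum_le _ _).trans_lt ?_
    rw [Finset.sup_lt_iff (WithBot.bot_lt_coe _)]
    intro σ hσ
    exact hoff σ (Finset.ne_of_mem_erase hσ)
  -- the bad set: `0` and the roots of the determinant
  refine ⟨insert 0 A.det.roots.toFinset, fun β₀ hβ₀ => ?_⟩
  rw [Finset.mem_insert, not_or, Multiset.mem_toFinset, mem_roots hdet] at hβ₀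
  obtain ⟨hβ0, hβroot⟩ := hβ₀
  have hdet' : ((Polynomial.evalRingHom β₀).mapMatrix A).det ≠ 0 := by
    rw [← RingHom.map_det]
    exact hβroot
  -- coordinates of the specialised words on the monomials `x_𝕁`
  set R' := rep (R := ℂ) (lamOf β₀) (muOf r s β₀) with hR'
  have hv : ∀ p, scal r β₀ (lst p) • R'.partitionVector p 1 =
      MvPolynomial.map (Polynomial.aeval β₀ : ℂ[X] →ₐ[ℂ] ℂ) (gvec r s (lst p)) :=
    fun p => (map_gvec r s hβ0 (hlst p)).symm
  -- independence of the rescaled specialised words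
  have hind : LinearIndependent ℂ fun p => scal r β₀ (lst p) • R'.partitionVector p 1 := by
    rw [Fintype.linearIndependent_iff]
    intro g hg
    have hvec : Matrix.vecMul g ((Polynomial.evalRingHom β₀).mapMatrix A) = 0 := by
      funext q
      have h1 := congrArg (MvPolynomial.coeff (mo q)) hg
      rw [MvPolynomial.coeff_sum, MvPolynomial.coeff_zero] at h1
      rw [Pi.zero_apply, ← h1, Matrix.vecMul, dotProduct]
      refine Finset.sum_congr rfl fun p _ => ?_
      rw [MvPolynomial.coeff_smul, smul_eq_mul, hv p, MvPolynomial.coeff_map, RingHom.mapMatrix_apply, Matrix.map_apply]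
      rfl
    exact fun p => congrFun (Matrix.eq_zero_of_vecMul_eq_zero hdet' hvec) p
  -- remove the (non-zero) scalars
  have hunit : ∀ p, IsUnit (scal r β₀ (lst p)) := fun p => (scal_ne_zero r hβ0 (hlst p)).isUnit
  have := hind.units_smul fun p => (hunit p).unit⁻¹
  convert this using 1
  funext p
  simp only [Pi.smul_apply', Units.smul_def]
  rw [smul_smul, IsUnit.val_inv_mul, one_smul]

end Generic


end Fock

end Literature.RepresentationTheory.Virasoro

end
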